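import Summits.ValiantsHypothesis.ValiantsHypothesis.Theorems.KPlusLogSqLawTropicalBThreeFiveKit
import Summits.ValiantsHypothesis.ValiantsHypothesis.Theorems.KPlusLogSqLawTropicalBRelabel

/-!
# Route «KPlusLogSqLaw», crux `TropicalB` (stmt-ValiantsHypothesis-19771) — certificate kit for the `(3,5)` row, part 2:
# from a refuted pattern to `n ≤ 33`; ties; row relabelling (`search1`)

HONEST FRAMING.  Helper toward the crux (cell `pub-symmetroid`, seat val-sym-trop-p4 g5, 2026-08-27; `--supports … --as helper`); the
second half of the certificate kit (`…ThreeFiveKit` = the order-type pairwise-law search `search` and its soundness).  No census claim here;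
nothing on `TropicalB` in its window, `WeakLifting`, the doors, `MatrixDescartes` (stmt-ValiantsHypothesis-18050) or VP ≠ VNP.

CONTENT.  `symSlope`; `le_33_of_search` (a refuted pattern whose histograms are slope-ordered by `d` ⇒ every sign-alternating dominant
chain of a `(3,5)` design with exponents `d` has `n ≤ 33`, since a 34-change chain carries all 35 histograms — `ForbiddenPatterns.exists_pos_of_ge`);
`le_33_of_tie₃` / `le_33_of_tie₂` / `le_33_of_tie₃'` (two distinct histograms or pair sums with equal slope ⇒ `n ≤ 33`); `search1` (first pattern
position restricted to the identity permutation) and `le_33_of_search1` (rows relabelled by the first term's permutation, dominance transferred by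
`isDominant_relabel_iff` of `…TropicalBRelabel`).  [this cell]
-/

-- `Summit.ValiantsHypothesis.ValiantsHypothesis.…` repeats a component by the D-0017 layout
-- (single-conjunct summit), which the `dupNamespace` linter flags; the name is mandated.
set_option linter.dupNamespace false
set_option autoImplicit false

namespace Summit.ValiantsHypothesis.ValiantsHypothesis.Theorems.KPlusLogSqLaw

open Summit.ValiantsHypothesis.ValiantsHypothesis.Theorems.MatrixDescartes.Negative
open Summit.ValiantsHypothesis.ValiantsHypothesis.Theorems.LacunarySymmetroidMatrixDescartes.TropicalCensus
open Finset ForbiddenPatterns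

namespace ThreeFive

/-! ## 3. From a refuted pattern to `n ≤ 33` -/

/-- slope of a class multiset. -/
def symSlope (d : Fin 5 → ℕ) (s : Sym (Fin 5) 3) : ℤ := ((s : Multiset (Fin 5)).map fun l => (d l : ℤ)).sum

/-- the slope of a term is the slope of its class multiset. -/
theorem slope_eq_symSlope (d : Fin 5 → ℕ) (q : Equiv.Perm (Fin 3) × (Fin 3 → Fin 5)) :
    slope d q = symSlope d (classSym q) := slope_eq_of_classSym d q

/-- evaluation of `symSlope` on an explicit multiset. -/
theorem symSlope_mk (d : Fin 5 → ℕ) (a b c : Fin 5) :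
    symSlope d (⟨{a, b, c}, by simp⟩ : Sym (Fin 5) 3) = (d a : ℤ) + d b + d c := by
  unfold symSlope
  simp [add_assoc]

/-- a chain along a `Forall₂`: mapping two functions over one list. -/
theorem forall₂_map_map {α β γ : Type*} (R : β → γ → Prop) (f : α → β) (g : α → γ) :
    ∀ l : List α, (∀ a ∈ l, R (f a) (g a)) → List.Forall₂ R (l.map f) (l.map g)
  | [], _ => List.Forall₂.nil
  | a :: l, h => List.Forall₂.cons (h a (List.mem_cons_self)) (forall₂_map_map R f g l fun x hx => h x (List.mem_cons_of_mem _ hx))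

/-- **`n ≤ 33` from a refuted pattern.**  If the search refutes the pattern `pat` (histograms with complete arrangement lists) under relations
that hold for the strictly increasing exponent vector `d`, and `d` puts the pattern's histograms in increasing slope order, then every
sign-alternating dominant chain of a `(3,5)` design with exponents `d` has at most `33` sign changes. -/
theorem le_33_of_search (R2 : Rel2) (R3 : Rel3) (pat : List (Sym (Fin 5) 3 × List (Fin 3 → Fin 5)))
    (hsearch : search R2 R3 [] (pat.map Prod.snd) = true)
    (harr : ∀ q ∈ pat, ∀ c : Fin 3 → Fin 5, (univ.val.map c : Multiset (Fin 5)) = (q.1 : Multiset (Fin 5)) → c ∈ q.2)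
    (d : Fin 5 → ℕ) (hd : StrictMono d)
    (hR2 : ∀ r ∈ R2, d r.1.1 + d r.1.2 < d r.2.1 + d r.2.2)
    (hR3 : ∀ r ∈ R3, d r.1.1 + d r.1.2.1 + d r.1.2.2 < d r.2.1 + d r.2.2.1 + d r.2.2.2)
    (hord : pat.IsChain (fun q q' => symSlope d q.1 < symSlope d q'.1))
    (v ε : Fin 3 → Fin 3 → Fin 5 → ℤ) (n : ℕ) (θ : Fin (n + 1) → ℤ)
    (p : Fin (n + 1) → Equiv.Perm (Fin 3) × (Fin 3 → Fin 5)) (hθ : StrictMono θ)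
    (hdom : ∀ k, IsDominant d v ε (θ k) (p k))
    (halt : ∀ k : Fin n, termSign ε (p k.castSucc) * termSign ε (p k.succ) < 0) : n ≤ 33 := by
  classical
  by_contra hn
  push Not at hn
  obtain ⟨hsm, hsurj⟩ := exists_pos_of_ge hθ hdom halt (by omega)
  -- positions of the pattern's histograms
  let pos : Sym (Fin 5) 3 × List (Fin 3 → Fin 5) → Fin (n + 1) := fun q => Classical.choose (hsurj q.1)
  have hpos : ∀ q, classSym (p (pos q)) = q.1 := fun q => Classical.choose_spec (hsurj q.1)
  let fut : List (ℤ × (Equiv.Perm (Fin 3) × (Fin 3 → Fin 5))) := pat.map fun q => (θ (pos q), p (pos q))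
  refine search_sound d v ε R2 R3 hd.monotone hR2 hR3 (pat.map Prod.snd) [] fut (by simpa using hsearch) ?_
    (fun a ha => by simp at ha) (fun f hf => ?_) (fun a ha => by simp at ha) ?_
  · -- class vectors lie in the prescribed arrangement lists
    refine forall₂_map_map _ _ _ pat fun q hq => harr q hq _ ?_
    have := congrArg (fun s : Sym (Fin 5) 3 => (s : Multiset (Fin 5))) (hpos q)
    simpa [classSym] using this
  · obtain ⟨q, -, rfl⟩ := List.mem_map.mp hf
    exact hdom _
  · -- increasing slopes of the pattern ⇒ increasing positions ⇒ increasing parameters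
    have hθlt : ∀ q q', symSlope d q.1 < symSlope d q'.1 → θ (pos q) < θ (pos q') := by
      intro q q' h
      apply hθ
      apply hsm.lt_iff_lt.mp
      show slope d (p (pos q)) < slope d (p (pos q'))
      rw [slope_eq_symSlope, slope_eq_symSlope, hpos, hpos]
      exact h
    have hc : pat.IsChain (fun q q' => θ (pos q) < θ (pos q')) := List.IsChain.imp (fun q q' h => hθlt q q' h) hord
    haveI : Trans (fun q q' : Sym (Fin 5) 3 × List (Fin 3 → Fin 5) => θ (pos q) < θ (pos q'))
        (fun q q' => θ (pos q) < θ (pos q')) (fun q q' => θ (pos q) < θ (pos q')) :=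
      ⟨fun h1 h2 => lt_trans h1 h2⟩
    have hpw : pat.Pairwise (fun q q' => θ (pos q) < θ (pos q')) := hc.pairwise
    exact List.pairwise_map.mpr hpw

/-- **tie of two histograms**: if two distinct class multisets have the same slope, a sign-alternating dominant chain of a `(3,5)` design has
`n ≤ 33` (its histograms are pairwise distinct with pairwise distinct slopes, so it misses one of the two). -/
theorem le_33_of_tie₃ (x y : Sym (Fin 5) 3) (hxy : x ≠ y) (d : Fin 5 → ℕ) (h : symSlope d x = symSlope d y)
    (v ε : Fin 3 → Fin 3 → Fin 5 → ℤ) (n : ℕ) (θ : Fin (n + 1) → ℤ)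
    (p : Fin (n + 1) → Equiv.Perm (Fin 3) × (Fin 3 → Fin 5)) (hθ : StrictMono θ)
    (hdom : ∀ k, IsDominant d v ε (θ k) (p k))
    (halt : ∀ k : Fin n, termSign ε (p k.castSucc) * termSign ε (p k.succ) < 0) : n ≤ 33 := by
  by_contra hn
  push Not at hn
  obtain ⟨hsm, hsurj⟩ := exists_pos_of_ge hθ hdom halt (by omega)
  obtain ⟨kx, hkx⟩ := hsurj x
  obtain ⟨ky, hky⟩ := hsurj y
  have hs : slope d (p kx) = slope d (p ky) := by rw [slope_eq_symSlope, slope_eq_symSlope, hkx, hky, h]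
  have hk : kx = ky := hsm.injective hs
  exact hxy (by rw [← hkx, ← hky, hk])

/-- **tie of two pair sums** `d a + d b = d c + d e` with `{a,b,0} ≠ {c,e,0}`: again `n ≤ 33`. -/
theorem le_33_of_tie₂ (a b c e : Fin 5)
    (hne : (⟨{a, b, 0}, by simp⟩ : Sym (Fin 5) 3) ≠ ⟨{c, e, 0}, by simp⟩) (d : Fin 5 → ℕ) (h : d a + d b = d c + d e)
    (v ε : Fin 3 → Fin 3 → Fin 5 → ℤ) (n : ℕ) (θ : Fin (n + 1) → ℤ)
    (p : Fin (n + 1) → Equiv.Perm (Fin 3) × (Fin 3 → Fin 5)) (hθ : StrictMono θ)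
    (hdom : ∀ k, IsDominant d v ε (θ k) (p k))
    (halt : ∀ k : Fin n, termSign ε (p k.castSucc) * termSign ε (p k.succ) < 0) : n ≤ 33 := by
  refine le_33_of_tie₃ _ _ hne d ?_ v ε n θ p hθ hdom halt
  rw [symSlope_mk, symSlope_mk]
  have : (d a : ℤ) + d b = d c + d e := by exact_mod_cast h
  linarith

/-- tie of two triple sums, numeric form. -/
theorem le_33_of_tie₃' (a b c a' b' c' : Fin 5)
    (hne : (⟨{a, b, c}, by simp⟩ : Sym (Fin 5) 3) ≠ ⟨{a', b', c'}, by simp⟩) (d : Fin 5 → ℕ)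
    (h : d a + d b + d c = d a' + d b' + d c')
    (v ε : Fin 3 → Fin 3 → Fin 5 → ℤ) (n : ℕ) (θ : Fin (n + 1) → ℤ)
    (p : Fin (n + 1) → Equiv.Perm (Fin 3) × (Fin 3 → Fin 5)) (hθ : StrictMono θ)
    (hdom : ∀ k, IsDominant d v ε (θ k) (p k))
    (halt : ∀ k : Fin n, termSign ε (p k.castSucc) * termSign ε (p k.succ) < 0) : n ≤ 33 := by
  refine le_33_of_tie₃ _ _ hne d ?_ v ε n θ p hθ hdom halt
  rw [symSlope_mk, symSlope_mk]
  exact_mod_cast h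

/-! ## 4. Row relabelling: the first pattern term may be taken with the identity permutation -/

/-- the search with the FIRST pattern position restricted to the identity permutation (rows relabelled). -/
def search1 (R2 : Rel2) (R3 : Rel3) : List (List (Fin 3 → Fin 5)) → Bool
  | [] => false
  | arrs :: rest => arrs.all fun c => search R2 R3 [(![0, 1, 2], c)] rest

/-- the identity permutation's vector. -/
theorem coe_one_eq : (⇑(1 : Equiv.Perm (Fin 3)) : Fin 3 → Fin 3) = ![0, 1, 2] := by
  funext b; fin_cases b <;> rfl

/-- **`n ≤ 33` from a pattern refuted by `search1`** (rows relabelled so that the first pattern term carries the identity permutation;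
dominance transfers by `isDominant_relabel_iff`). -/
theorem le_33_of_search1 (R2 : Rel2) (R3 : Rel3) (pat : List (Sym (Fin 5) 3 × List (Fin 3 → Fin 5)))
    (hsearch : search1 R2 R3 (pat.map Prod.snd) = true)
    (harr : ∀ q ∈ pat, ∀ c : Fin 3 → Fin 5, (univ.val.map c : Multiset (Fin 5)) = (q.1 : Multiset (Fin 5)) → c ∈ q.2)
    (d : Fin 5 → ℕ) (hd : StrictMono d)
    (hR2 : ∀ r ∈ R2, d r.1.1 + d r.1.2 < d r.2.1 + d r.2.2)
    (hR3 : ∀ r ∈ R3, d r.1.1 + d r.1.2.1 + d r.1.2.2 < d r.2.1 + d r.2.2.1 + d r.2.2.2)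
    (hord : pat.IsChain (fun q q' => symSlope d q.1 < symSlope d q'.1))
    (v ε : Fin 3 → Fin 3 → Fin 5 → ℤ) (n : ℕ) (θ : Fin (n + 1) → ℤ)
    (p : Fin (n + 1) → Equiv.Perm (Fin 3) × (Fin 3 → Fin 5)) (hθ : StrictMono θ)
    (hdom : ∀ k, IsDominant d v ε (θ k) (p k))
    (halt : ∀ k : Fin n, termSign ε (p k.castSucc) * termSign ε (p k.succ) < 0) : n ≤ 33 := by
  classical
  by_contra hn
  push Not at hn
  obtain ⟨hsm, hsurj⟩ := exists_pos_of_ge hθ hdom halt (by omega)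
  let pos : Sym (Fin 5) 3 × List (Fin 3 → Fin 5) → Fin (n + 1) := fun q => Classical.choose (hsurj q.1)
  have hpos : ∀ q, classSym (p (pos q)) = q.1 := fun q => Classical.choose_spec (hsurj q.1)
  -- the pattern is nonempty (else `search1 = false`)
  obtain ⟨q₀, pat', rfl⟩ : ∃ q₀ pat', pat = q₀ :: pat' := by
    cases pat with
    | nil => simp [search1] at hsearch
    | cons q₀ pat' => exact ⟨q₀, pat', rfl⟩
  -- relabel the rows by the permutation of the first pattern term
  set π : Equiv.Perm (Fin 3) := (p (pos q₀)).1 with hπ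
  let v' : Fin 3 → Fin 3 → Fin 5 → ℤ := fun a b l => v (π a) b l
  let ε' : Fin 3 → Fin 3 → Fin 5 → ℤ := fun a b l => ε (π a) b l
  let p' : Fin (n + 1) → Equiv.Perm (Fin 3) × (Fin 3 → Fin 5) := fun k => (π⁻¹ * (p k).1, (p k).2)
  have hdom' : ∀ k, IsDominant d v' ε' (θ k) (p' k) := by
    intro k
    have h := (isDominant_relabel_iff d v ε π 1 (π⁻¹ * (p k).1, (p k).2) (θ k)).mp
    have e : ((π * (π⁻¹ * (p k).1) * (1 : Equiv.Perm (Fin 3))⁻¹ : Equiv.Perm (Fin 3)),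
        fun j => (p k).2 (((1 : Equiv.Perm (Fin 3))⁻¹) j)) = p k := by
      ext1
      · ext1 x; simp
      · funext j; simp
    rw [e] at h
    simpa [v', ε'] using h (hdom k)
  let fut : List (ℤ × (Equiv.Perm (Fin 3) × (Fin 3 → Fin 5))) := pat'.map fun q => (θ (pos q), p' (pos q))
  let f₀ : ℤ × (Equiv.Perm (Fin 3) × (Fin 3 → Fin 5)) := (θ (pos q₀), p' (pos q₀))
  -- unpack `search1`
  have hs1 : search R2 R3 [(![0, 1, 2], (p (pos q₀)).2)] (pat'.map Prod.snd) = true := by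
    simp only [search1, List.map_cons, List.all_eq_true] at hsearch
    refine hsearch _ (harr q₀ (List.mem_cons_self) _ ?_)
    have := congrArg (fun s : Sym (Fin 5) 3 => (s : Multiset (Fin 5))) (hpos q₀)
    simpa [classSym] using this
  have habs : [(![0, 1, 2], (p (pos q₀)).2)] = [f₀].map fun a => abs a.2 := by
    simp only [List.map_cons, List.map_nil, abs, f₀, p']
    rw [hπ, inv_mul_cancel, coe_one_eq]
  rw [habs] at hs1
  have hθlt : ∀ q q', symSlope d q.1 < symSlope d q'.1 → θ (pos q) < θ (pos q') := by
    intro q q' h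
    apply hθ
    apply hsm.lt_iff_lt.mp
    show slope d (p (pos q)) < slope d (p (pos q'))
    rw [slope_eq_symSlope, slope_eq_symSlope, hpos, hpos]
    exact h
  have hc : (q₀ :: pat').IsChain (fun q q' => θ (pos q) < θ (pos q')) := List.IsChain.imp (fun q q' h => hθlt q q' h) hord
  haveI : Trans (fun q q' : Sym (Fin 5) 3 × List (Fin 3 → Fin 5) => θ (pos q) < θ (pos q'))
      (fun q q' => θ (pos q) < θ (pos q')) (fun q q' => θ (pos q) < θ (pos q')) :=
    ⟨fun h1 h2 => lt_trans h1 h2⟩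
  have hpw : (q₀ :: pat').Pairwise (fun q q' => θ (pos q) < θ (pos q')) := hc.pairwise
  refine search_sound d v' ε' R2 R3 hd.monotone hR2 hR3 (pat'.map Prod.snd) [f₀] fut hs1 ?_ ?_ ?_ ?_ ?_
  · refine forall₂_map_map _ _ _ pat' fun q hq => harr q (List.mem_cons_of_mem _ hq) _ ?_
    have := congrArg (fun s : Sym (Fin 5) 3 => (s : Multiset (Fin 5))) (hpos q)
    simpa [classSym] using this
  · intro a ha
    rw [List.mem_singleton] at ha
    subst ha
    exact hdom' _
  · intro f hf
    obtain ⟨q, -, rfl⟩ := List.mem_map.mp hf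
    exact hdom' _
  · intro a ha f hf
    rw [List.mem_singleton] at ha
    subst ha
    obtain ⟨q, hq, rfl⟩ := List.mem_map.mp hf
    exact List.rel_of_pairwise_cons hpw hq
  · exact List.pairwise_map.mpr hpw.of_cons

end ThreeFive

end Summit.ValiantsHypothesis.ValiantsHypothesis.Theorems.KPlusLogSqLaw
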